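import Summits.QuantumFields.BalabanUV.Beta.D1BFx.RoadEndBFxTotalShellGroupsS
import Summits.QuantumFields.BalabanUV.Beta.D1BFx.RoadEndGroupsS
import Summits.QuantumFields.BalabanUV.Beta.D1BFx.RoadEndBFxWired
import Summits.QuantumFields.BalabanUV.Beta.D1BFx.NeedleTadpoleRowDecay

/-!
# `BalabanUV.Beta.D1BFx.RoadEndBFxWiredS` — road «BF-x» for binder row D1, slot (K): **THE «END-ii» END** (`END-ii-SPEC.md` v1.1; owner ruling ρ-g11-9 «GHOST UNITS»;
# binder GO R-D1-g31-2) — the debt END of record `RoadEndBFxWired.d1Drift_BFx_of_prop12_of_rows'` under the CONSISTENT ghost reading: tie RESCALED by `s n = n⁻²`,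
# ghost graded words at `n⁻²·gfrz`, and the ghost sector's rest inputs («L-GBUB» ×3, T₄–T₇) SUPPLIED by tree theorems; one open rest input left: T₈

HONEST DEPENDENCY (cell records, verbatim): «continuum YM on T⁴ ⇐ BetaPertH ∧ nine spine estimates (0/9 proved); BetaPertH ⇐ (D1) ∧ (D4) ∧
CAP+tail; G-an2-4 gates asym, D1 and NE2/3/4.»  HONEST FRAMING (cell contract, verbatim): «discharging `BetaPertH` makes Bałaban's UV stability
UNCONDITIONAL — a real constructive-QFT result; it is NOT the continuum limit and NOT the Clay problem.»  THIS MODULE DISCHARGES NOTHING of the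
wall: [folklore] composition BY NAME of `RoadEndBFxTotalShellGroupsS.d1Drift_BFx_total_shell_of_prop12_of_groupsS` (ENDₛ chain links 1–5: `SplitInstanceS`,
`AssemblyEndRecutS`, `AssemblyEndTotalS`, `RestTotalOf{Words,Groups}S`, `RoadEndBFxTotalShellS`) with `RoadEndGroupsS.hGrp_of_prop12S` (the group rows: `LocalGroupRowS`,
`RoadEndBFxRowsS`, `NeedleRowGlueS`, `NeedleRowsAtRayS` over the swarm's reading-(ii) rows).  No `def`, no `def … : Prop`, nothing cited, 0 sorry.  Root-level binders
hW ∕ hR-sockets ∕ hSX-socket ∕ D1Tel ∕ D1Rep — 0 discharged; (K) NOT closed; NOT D1, NOT `BetaPertH`, NOT continuum, NOT Clay.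

ABSOLUTE RULE (cell charter, verbatim): «No internally-minted statement may enter as a cited fact. Every hypothesis is either kernel-proved in
this package or a verbatim quotation of a PUBLISHED theorem with page reference. The manuscript(s) under audit are NOT citable for their own
disputed steps — they are the thing under adjudication; programme-internal (2001/route/tribunal) claims are never citable.»

WHY.  The END of record (`RoadEndBFxWired`, p281842 ∕ v1.1 p287515) ties the loop weights by `hω : ω_gh·cK² = −2·ω_gl·cE²`, which mis-transcribes R-4(v) «ghost −2 :
gluon +1» by `n⁴` against the TYPED ghost leg (an3-g63's audit, adopted ρ-g11-9): it is kernel-true but its ghost-rest slots (`hGbub`, and the rows T₄–T₇ «met at the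
ray») are unsatisfiable by Bałaban's kernels.  THIS FILE is the same END under the consistent reading: every gluon-side object, the MAIN value `stK μ ν N gfrz`, the
`11N²∕3` coefficient, the shell telescoping, the sockets and the (K) slot are untouched; the tie and the ghost words' profile change; and the ghost rest rows, re-counted
by the swarm at the `n⁴`-larger letters (an3-g65's census), are now SUPPLIED.  CHECK-N0 items that remain OUTSIDE this file (an2 ∕ binder): Q-GU-1′(a) (is R-4(v)'s block
form an identity of [I] (1.4)–(1.5)'s `log Z`), S-x₀ (the sign `x₀∕cgh = −1`), N0-abs (`n⁻⁸·lam = 1`, `cE = n⁴`), Q-GU-aux (the gluon gauge sector's `(cK, cQ)`).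

CONTENT.
* [folklore] **`d1Drift_BFx_of_prop12S`** — `D1Drift Lc Js N μ ν` from the displayed list above; open rest input: `h₈` only.
* §2 (v1.1, APPEND-ONLY; the v1 declaration byte-identical) [folklore] **`d1Drift_BFx_of_prop12S'`** — T₈ from slot Q's SOCKETS (leaf-04-g14's
  `NeedleTadpoleRowDecay.h₈_of_blockRate_scaling`) and `hrowgh` from the ray: NO rest-word row displayed.
Unit `b2b-balaban-beta-d1-p2` (gen 12), road «BF-x» OWNER; `LEAVES-BFx.md` row «END-WIRED-S ∕ END-ii»; END-ii-SPEC v1.1 §§2–3.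
-/

noncomputable section

open Finset Filter Topology
open Literature.Probability.LatticeModels (annulus)
open scoped BigOperators
open Literature.MathematicalPhysics.QuantumFieldTheory.Balaban1983to89
open Literature.MathematicalPhysics.QuantumFieldTheory.Balaban1983to89.Beta
open OneStepResolventKernel (JetData KInv)
open OneStepKernelFamily (TbalOf D1Drift)
open InterLevelTransport (onLat)
open BalabanStepJets (lamCoeffOf)
open AveragingHessianKernels (hessFF)
open KernelWard (divV)
open WindowIdentification (fullSum psum)
open B12Sec2to5 (l1)
open DyadicShell (Pt toReal supNorm)
open ExpKernelCalculus (Site MKer BiLoc shiftK comp)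
open GhostTable (gFree)
open BubbleTransfer (unitVec)
open DressedMomentNormalisation (resSite)
open PoissonInterior (nrm)
open Summit.QuantumFields.BalabanUV.Beta.TameKernelCalculus (Spr Loc trK)
open Summit.QuantumFields.BalabanUV.Beta.D1BFx.ReducedKernel (TableR TOfRed)
open Summit.QuantumFields.BalabanUV.Beta.D1BFx.DressedTadpoleTable (tableRed tadpoleTable)
open Summit.QuantumFields.BalabanUV.Beta.D1BFx.ReducedKernelSandwich (fineHess)
open Summit.QuantumFields.BalabanUV.Beta.D1BFx.FineStencilBF (ffOf)
open Summit.QuantumFields.BalabanUV.Beta.D1BFx.FineStencilBFBalaban (SbfBal)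
open Summit.QuantumFields.BalabanUV.Beta.D1BFx.SecondStencilBF (Wbf)
open Summit.QuantumFields.BalabanUV.Beta.D1BFx.FineHessianSectors (slotWt slotTab)
open Summit.QuantumFields.BalabanUV.Beta.D1BFx.GhostKernelComplete (PghQ fineHessGhQ)
open Summit.QuantumFields.BalabanUV.Beta.D1BFx.GluonLeg (Ga)
open Summit.QuantumFields.BalabanUV.Beta.D1BFx.GhostLeg (Ggh)
open Summit.QuantumFields.BalabanUV.Beta.D1BFx.RProjector (Pgt)
open Summit.QuantumFields.BalabanUV.Beta.D1BFx.RProjectorJet (RG)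
open Summit.QuantumFields.BalabanUV.Beta.D1BFx.SectorRecut (SbT)
open Summit.QuantumFields.BalabanUV.Beta.D1BFx.GluonNeedleSplit (dipPiece ndlPiece)
open Summit.QuantumFields.BalabanUV.Beta.D1BFx.GluonNeedleGlue (cellSum)
open Summit.QuantumFields.BalabanUV.Beta.D1BFx.FrozenLegProfile (gfrz)
open Summit.QuantumFields.BalabanUV.Beta.D1BFx.SplitInstance (RestIdx)
open Summit.QuantumFields.BalabanUV.Beta.D1BFx.SplitRecut (restK')
open Summit.QuantumFields.BalabanUV.Beta.D1BFx.SplitInstanceS (restKS)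
open Summit.QuantumFields.BalabanUV.Beta.D1BFx.RankOneBubble (applyK pairing)
open Summit.QuantumFields.BalabanUV.Beta.D1BFx.RankOneBubbleJets (grad)
open Summit.QuantumFields.BalabanUV.Beta.D1BFx.RoadEndBFxRows (grpRec grpRec_eq_three_iff)
open Summit.QuantumFields.BalabanUV.Beta.D1BFx.RoadEndBFxTotalShellGroupsS (d1Drift_BFx_total_shell_of_prop12_of_groupsS)
open Summit.QuantumFields.BalabanUV.Beta.D1BFx.RoadEndGroupsS (hGrp_of_prop12S)
open Summit.QuantumFields.BalabanUV.Beta.D1BFx.FrozenLegTails (nOf MOf hn1)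
open VectorTailsLoc (fam kfam)

namespace Summit.QuantumFields.BalabanUV.Beta.D1BFx.RoadEndBFxWiredS

variable {Lc : ℕ} [NeZero Lc] {a N cgh₀ : ℝ} {μ ν : Fin 4} {υ : Type*} [Fintype υ]
  {cE cVH cΛ cR cK cQ cE₂ cJ4 cΛ₂ cR₂ cQ₂ x₀ ωgl ωgh cgh : ℕ → ℝ} {WE WJ WΛ WR WQ : ℕ → TableR} {CE CJ CΛt CRt CQ δW : ℕ → ℝ}
  {Ru : υ → ℕ → ℝ} {CU : υ → ℝ} {D₂ U₁ : ℝ}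
  {TΛ WA : ℕ → Fin 4 → Site 4 → Fin 4 → Site 4 → MKer 4 (Fin 4)} {CT δT : ℕ → ℝ}
  {ε : ℕ → ℝ} {X : ℕ → Site 4 → MKer 4 (Fin 4)} {Cx δx : ℕ → ℝ}

/-- [folklore] **ROAD BF-x, THE «END-ii» END: THE DEBT END WITH THE REST ROW WIRED UNDER THE CONSISTENT GHOST READING** — `RoadEndBFxWired.d1Drift_BFx_of_prop12_of_rows'`
with (Δ1) the loop-weight tie RESCALED (`hωs : ω_gh n·(s n·cK n)² = −2·ω_gl n·cE n²`, displayed family `s`, pin `hs : s n = n⁻²`; at the ray `cK = cgh·n²` this is R-4(v)'s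
prefactor-level tie `ω_gh·cgh² = −2·ω_gl·cE²`), (Δ2) the rest words read from the two-profile table `restKS n a (gfrz n a b) (s n • gfrz n a b)` (ghost graded words at the
regraded profile — inside `hGrp_of_prop12S`, not displayed), and — the POINT — the ghost sector's rest inputs NO LONGER DISPLAYED: «L-GBUB» ×3 and T₄–T₇ are tree theorems
under reading (ii) (`GhostBubbleTailsII`, `NeedleGhostBubbleRowMass10{,T5}`, `NeedleGhostBubble2RowMass8`, `NeedleGhostTadpoleRowMass8`).  `D1Drift Lc Js N μ ν` for ANY `Js`,
`μ ≠ ν`, `N ≠ 0`, odd `Lc ≥ 2`, from, DISPLAYED VERBATIM: bridge B1 `hB1`; (K) `hK` + `hωs` + `hs` + `hlam`; the pins `hcE`∕`hRsgn`∕`hJ4`; the ray `hKray`∕`hQray`∕`hx` with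
`|cgh n| ≤ cgh₀` (P13); the five slot-table sockets with covariance and bond swap; `hdiv`; `hrowgh`; the shell rows `h2s`∕`d2s`; slot-E's support ∕ rate floor ∕ units; slot R's
SOCKETS (`hWRenv`, `hkR`, …); the (Λ) sockets + `cΛ ≠ 0`, `ε = ±1`, `hX`, (W1), (W2′); (U); the two PRINTED statements `h12`∕`h126` BY NAME; and ONE open rest input, the slot-4
tadpole row `h₈` (T₈: `WQ` awaits the (A2) pin).  HONEST: composition BY NAME; the END of record (p287515) stays as it is (reading (i), kernel-true, ghost-rest slots
unsatisfiable for Bałaban's kernels); root-level binders hW ∕ hR-sockets ∕ hSX-socket ∕ D1Tel ∕ D1Rep — 0 discharged; (K) NOT closed; NOT D1, NOT `BetaPertH`, NOT continuum,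
NOT Clay. -/
theorem d1Drift_BFx_of_prop12S (Js : ℕ → JetData 3 Lc) (hμν : μ ≠ ν) (hN : N ≠ 0) (hL : 2 ≤ Lc) (hodd : Odd Lc)
    (ha : 0 < a) (c : ℕ → ℝ) {A₂ δ₂ : ℝ} (hD₂ : 0 ≤ D₂) (hA₂ : 0 ≤ A₂) (hδ₂ : 0 < δ₂)
    (h12 : B5.Prop12Printed (fam nOf hn1 MOf a ha)) (h126 : B5.Kernel126_127Printed (kfam nOf MOf))
    (h2s : ∀ n : ℕ, 2 ≤ n → ∀ [NeZero n], ∀ b ∈ (univ : Finset (Fin 4 → Fin n)).image resSite, ∀ r : ℕ, r + 1 ≤ n →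
      ∑ v ∈ annulus 4 r (r + 1), |(gfrz n a b (v + unitVec ν + unitVec μ) - gFree (v + unitVec ν + unitVec μ)) -
          (gfrz n a b (v + unitVec ν) - gFree (v + unitVec ν)) - (gfrz n a b (v + unitVec μ) - gFree (v + unitVec μ)) +
          (gfrz n a b v - gFree v)| ≤ D₂ / (n : ℝ))
    (d2s : ∀ n : ℕ, 2 ≤ n → ∀ [NeZero n], ∀ b ∈ (univ : Finset (Fin 4 → Fin n)).image resSite, ∀ r : ℕ, n ≤ r →
      ∑ v ∈ annulus 4 r (r + 1), |gfrz n a b (v + unitVec ν + unitVec μ) - gfrz n a b (v + unitVec ν) - gfrz n a b (v + unitVec μ) + gfrz n a b v| ≤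
        A₂ * Real.exp (-(δ₂ / n) * ((r : ℝ) + 1)) / ((r : ℝ) + 1))
    (hB1 : ∀ m : ℕ, 1 ≤ m → |(∑ j ∈ range m, B12Beta.secondMoment (TbalOf Lc Js j) μ ν) - c (Lc ^ m)| ≤ U₁)
    (hK : ∀ n : ℕ, 2 ≤ n → Odd n → ∀ [NeZero n], c n =
      ωgl n * B12Beta.secondMoment (TOfRed n a (SbfBal n a (cE n) (cVH n) (cΛ n) (cR n) (cK n) (cQ n))
        (tableRed n (Wbf (cE₂ n) (cJ4 n) (cΛ₂ n) (cR₂ n) (cQ₂ n) (WE n) (WJ n) (WΛ n) (WR n) (WQ n)))) μ ν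
      + ωgh n * B12Beta.secondMoment (PghQ n a (x₀ n) (cK n) (cQ n)) μ ν + ∑ u, Ru u n)
    -- the RESCALED loop-weight tie of reading (ii): displayed scalar family `s`, pinned `s n = n⁻²`; the normalisation
    (s : ℕ → ℝ) (hs : ∀ n : ℕ, 2 ≤ n → s n = ((n : ℝ) ^ 2)⁻¹) (hωs : ∀ n : ℕ, 2 ≤ n → ωgh n * (s n * cK n) ^ 2 = -2 * (ωgl n * cE n ^ 2))
    (hlam : ∀ n : ℕ, 2 ≤ n → ωgl n * cE n ^ 2 = 2 * N ^ 2 * (n : ℝ) ^ 8)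
    -- pins and the ray (the rows' letters)
    (hcE : ∀ n : ℕ, 2 ≤ n → cE n = (n : ℝ) ^ 4) (hRsgn : ∀ n : ℕ, 2 ≤ n → cR n = -cE n) (hJ4 : ∀ n : ℕ, cJ4 n = 0)
    (hcgh : ∀ n : ℕ, |cgh n| ≤ cgh₀) (hKray : ∀ n : ℕ, cK n = cgh n * (n : ℝ) ^ 2) (hQray : ∀ n : ℕ, cQ n = cgh n * a) (hx : ∀ n : ℕ, x₀ n = -cgh n)
    -- slot-table sockets (the END's), covariance, bond swap
    (hδW : ∀ n, 0 < δW n)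
    (hE : ∀ n κ u l u', BiLoc (WE n κ u l u') u u' (CE n) (δW n)) (hJ : ∀ n κ u l u', BiLoc (WJ n κ u l u') u u' (CJ n) (δW n))
    (hΛ : ∀ n κ u l u', BiLoc (WΛ n κ u l u') u u' (CΛt n) (δW n)) (hR : ∀ n κ u l u', BiLoc (WR n κ u l u') u u' (CRt n) (δW n))
    (hQ : ∀ n κ u l u', BiLoc (WQ n κ u l u') u u' (CQ n) (δW n))
    (hEc : ∀ (n : ℕ) (κ : Fin 4) (u : Site 4) (l : Fin 4) (u' t : Site 4),
      WE n κ (u + (n : ℤ) • t) l (u' + (n : ℤ) • t) = shiftK (-((n : ℤ) • t)) (WE n κ u l u'))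
    (hJc : ∀ (n : ℕ) (κ : Fin 4) (u : Site 4) (l : Fin 4) (u' t : Site 4),
      WJ n κ (u + (n : ℤ) • t) l (u' + (n : ℤ) • t) = shiftK (-((n : ℤ) • t)) (WJ n κ u l u'))
    (hΛc : ∀ (n : ℕ) (κ : Fin 4) (u : Site 4) (l : Fin 4) (u' t : Site 4),
      WΛ n κ (u + (n : ℤ) • t) l (u' + (n : ℤ) • t) = shiftK (-((n : ℤ) • t)) (WΛ n κ u l u'))
    (hRc : ∀ (n : ℕ) (κ : Fin 4) (u : Site 4) (l : Fin 4) (u' t : Site 4),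
      WR n κ (u + (n : ℤ) • t) l (u' + (n : ℤ) • t) = shiftK (-((n : ℤ) • t)) (WR n κ u l u'))
    (hQc : ∀ (n : ℕ) (κ : Fin 4) (u : Site 4) (l : Fin 4) (u' t : Site 4),
      WQ n κ (u + (n : ℤ) • t) l (u' + (n : ℤ) • t) = shiftK (-((n : ℤ) • t)) (WQ n κ u l u'))
    (hEs : ∀ n κ u l u', WE n κ u l u' = WE n l u' κ u) (hJs : ∀ n κ u l u', WJ n κ u l u' = WJ n l u' κ u)
    (hΛs : ∀ n κ u l u', WΛ n κ u l u' = WΛ n l u' κ u) (hRs : ∀ n κ u l u', WR n κ u l u' = WR n l u' κ u)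
    (hQs : ∀ n κ u l u', WQ n κ u l u' = WQ n l u' κ u)
    (hdiv : ∀ n : ℕ, 2 ≤ n → ∀ [NeZero n], ∀ (l' : Fin 4) (u' u : Site 4), ∑ κ' : Fin 4,
      (fineHess n a (SbfBal n a (cE n) (cVH n) (cΛ n) (cR n) (cK n) (cQ n))
          (Wbf (cE₂ n) (cJ4 n) (cΛ₂ n) (cR₂ n) (cQ₂ n) (WE n) (WJ n) (WΛ n) (WR n) (WQ n)) κ' l' (u - Pi.single κ' 1) u'
        - fineHess n a (SbfBal n a (cE n) (cVH n) (cΛ n) (cR n) (cK n) (cQ n))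
          (Wbf (cE₂ n) (cJ4 n) (cΛ₂ n) (cR₂ n) (cQ₂ n) (WE n) (WJ n) (WΛ n) (WR n) (WQ n)) κ' l' u u') = 0)
    (hrowgh : ∀ n : ℕ, 2 ≤ n → ∀ [NeZero n], ∀ (κ' l' : Fin 4) (b : Site 4), HasSum (fineHessGhQ n a (x₀ n) (cK n) (cQ n) κ' l' b) 0)
    -- (LOCAL) slot-E support and units; slot-R envelope and units (the three local ghost bubbles are SUPPLIED under reading (ii))
    {ρE : ℕ} {δ₀ kE : ℝ} (hδ₀ : 0 < δ₀) (hδE : ∀ n, δ₀ ≤ δW n)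
    (hsuppE : ∀ n κ u l u', ρE < supNorm (u - u') → WE n κ u l u' = 0)
    (hkE : ∀ n : ℕ, 2 ≤ n → |ωgl n * cE₂ n| * CE n ≤ kE * (n : ℝ) ^ 8)
    {CwR δR : ℕ → ℝ} {θR δ₀R kR : ℝ} (hθR : 0 < θR) (hδR : ∀ n, 0 < δR n) (hδ₀R : 0 < δ₀R) (hδRge : ∀ n : ℕ, δ₀R / n ≤ δR n) (hCwR : ∀ n, 0 ≤ CwR n)
    (hWRenv : ∀ n κ u l u', BiLoc (WR n κ u l u') u u' (CwR n * Real.exp (-(θR / n) * supNorm (u - u'))) (δR n))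
    (hkR : ∀ n : ℕ, 2 ≤ n → |ωgl n * cR₂ n| * CwR n * (n : ℝ) ^ 6 ≤ kR)
    -- (Λ) sockets and zero-momentum data
    (hδT : ∀ n, 0 < δT n)
    (hdec : ∀ n : ℕ, 2 ≤ n → ∀ [NeZero n], ∀ κ u l u', WΛ n κ u l u' =
      (∑ m : Fin 4, OneStepResolventKernel.wsum (onLat n (fun y => lamCoeffOf (KInv (N := n) (d := 3)) n m y l u'))
          (fun v => onLat n (fun y => TΛ n m y κ u) v))
      + (∑ m : Fin 4, OneStepResolventKernel.wsum (onLat n (fun y => lamCoeffOf (KInv (N := n) (d := 3)) n m y κ u))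
          (fun v => onLat n (fun y => TΛ n m y l u') v))
      + WA n κ u l u')
    (hTloc : ∀ (n : ℕ) m y κ u, BiLoc (TΛ n m y κ u) ((n : ℤ) • y) ((n : ℤ) • y) (CT n * Real.exp (-δT n * l1 ((n : ℤ) • y - u))) (δT n))
    (hWAa : ∀ n κ u l u', trK (WA n κ u l u') = -WA n κ u l u') (hWAl : ∀ n κ u l u', Loc (WA n κ u l u'))
    (hTcov : ∀ (n : ℕ) m y κ u t, TΛ n m (y + t) κ (u + (n : ℤ) • t) = shiftK (-((n : ℤ) • t)) (TΛ n m y κ u))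
    (hcΛ : ∀ n : ℕ, 2 ≤ n → cΛ n ≠ 0) (hε : ∀ n : ℕ, ε n = 1 ∨ ε n = -1) (hδx : ∀ n, 0 < δx n) (hX : ∀ n u, BiLoc (X n u) u u (Cx n) (δx n))
    (hW1 : ∀ n : ℕ, 2 ≤ n → ∀ [NeZero n], ∀ u,
      comp (comp (Ga n a) (divV (fun κ v => ε n • SbfBal n a (cE n) (cVH n) (cΛ n) (cR n) (cK n) (cQ n) κ v) u)) (Ga n a) =
        comp (Ga n a) (X n u) - comp (X n u) (Ga n a))
    (hW2 : ∀ n : ℕ, 2 ≤ n → ∀ [NeZero n], ∀ (m : Fin 4) (u : Site 4),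
      divV (fun κ v => (-(ε n * (cΛ₂ n / cΛ n))) • TΛ n m 0 κ v) u = comp (X n u) (ffOf (hessFF n m 0)) - comp (ffOf (hessFF n m 0)) (X n u))
    -- (N) the slot-4 tadpole row T₈
    {C₈ : ℝ}
    (h₈ : ∀ n : ℕ, 2 ≤ n → ∀ [NeZero n], |ωgl n * cQ₂ n * ∑ b ∈ (univ : Finset (Fin 4 → Fin n)).image resSite, ((n : ℝ) ^ 4)⁻¹ * (((n : ℝ) ^ 8)⁻¹ *
      fullSum (fun w : Pt => toReal w μ * toReal w ν * tadpoleTable n a (WQ n) μ ν (b + w) b))| ≤ C₈)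
    -- (U)
    (hU : ∀ n : ℕ, 2 ≤ n → ∀ u, |Ru u n| ≤ CU u) :
    D1Drift Lc Js N μ ν := by
  obtain ⟨CGv, hGrp⟩ := hGrp_of_prop12S (N := N) (cVH := cVH) (cE := cE) (cΛ := cΛ) (cR := cR) (cK := cK) (cQ := cQ) (cE₂ := cE₂) (cJ4 := cJ4)
    (cΛ₂ := cΛ₂) (cR₂ := cR₂) (cQ₂ := cQ₂) (x₀ := x₀) (ωgl := ωgl) (ωgh := ωgh) (WE := WE) (WJ := WJ) (WΛ := WΛ) (WR := WR) (WQ := WQ)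
    ha hμν h12 h126 hlam hcE hRsgn hJ4 s hs hωs hcgh hKray hQray hx hδW hE hJ hΛ hR hQ hδ₀ hδE hsuppE hkE hθR hδR hδ₀R hδRge hCwR hWRenv hkR hδT hdec hTloc
    hWAa hWAl hTcov hcΛ hε hδx hX hW1 hW2 h₈
  exact d1Drift_BFx_total_shell_of_prop12_of_groupsS (grp := grpRec) (g₀ := (3 : Fin 4)) (CG := CGv) Js hμν hN hL hodd ha c hD₂ hA₂ hδ₂ h12 h126 h2s d2s
    hB1 hK s hωs hlam hδW hE hJ hΛ hR hQ hEc hJc hΛc hRc hQc hEs hJs hΛs hRs hQs hdiv hrowgh grpRec_eq_three_iff hGrp hU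


/-! ## §2 (v1.1, APPENDED 2026-08-21 after leaf-04-g14's «T₈ PREP» `NeedleTadpoleRowDecay` landed) THE END-ii END WITH NO REST-WORD ROW DISPLAYED: T₈ from slot Q's
SOCKETS, and the ghost Ward rows from the ray pins -/

open Summit.QuantumFields.BalabanUV.Beta.D1BFx.NeedleTadpoleRowDecay (h₈_of_blockRate_scaling) in
open Summit.QuantumFields.BalabanUV.Beta.D1BFx.GhostKernelComplete (hasSum_row_fineHessGhQ_ray) in
/-- [folklore] **ROAD BF-x, THE «END-ii» END, v1.1 — NO REST-WORD ROW DISPLAYED.**  `d1Drift_BFx_of_prop12S` with (α) its last rest input `h₈` (the slot-4 gluon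
tadpole row T₈) SUPPLIED by leaf-04-g14's `NeedleTadpoleRowDecay.h₈_of_blockRate_scaling` from slot Q's SOCKETS — the (A2) readout of `WQ` displayed letter for letter as
slot R's (`hθQ`∕`hδQ`∕`hδ₀Q`∕`hδQge`∕`hCwQ`: a decaying bi-localisation envelope `CwQ n·e^{−(θQ∕n)‖u−u′‖}` at a BLOCK-scale rate floor `δ₀Q∕n ≤ δQ n`; `hkQ`: the units line
`|ωgl n·cQ₂ n|·CwQ n·n⁶ ≤ kQ` — WHICH values Bałaban's `WQ` has is the (A2) pin, PIN-MAP Q-PM-1∕2, NOT here; leaf-04-g14's docking cert `CERT-T8-socket-ENDii-fit` 9ff0d49881851c25),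
and (β) the ghost Ward rows `hrowgh` DISCHARGED on the ray (`x₀ = −cgh`, `cK = cgh·n²`, `cQ = cgh·a` ⇒ `GhostKernelComplete.hasSum_row_fineHessGhQ_ray`, as in
`RoadEndBFxRecutRay`).  DISPLAYED, VERBATIM otherwise: bridge B1 `hB1`; (K) `hK`; the tie `hωs` + pin `hs` + `hlam`; the pins `hcE`∕`hRsgn`∕`hJ4`; the ray `hKray`∕`hQray`∕`hx` with
`|cgh n| ≤ cgh₀` (P13); the five slot-table sockets with covariance and bond swap; `hdiv`; the shell rows `h2s`∕`d2s`; slot E's support ∕ rate floor ∕ units; slot R's and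
slot Q's SOCKETS; the (Λ) sockets + `cΛ ≠ 0`, `ε = ±1`, `hX`, (W1), (W2′); (U); the two PRINTED statements `h12`∕`h126` BY NAME.  ⇒ `D1Drift Lc Js N μ ν` for ANY `Js`,
`μ ≠ ν`, `N ≠ 0`, odd `Lc ≥ 2`.  HONEST: composition BY NAME; every remaining hypothesis is a socket ∕ letter ∕ pin ∕ printed statement — NONE is a rest-word ROW;
0 root-level binders discharged (hW ∕ hR-sockets ∕ hSX-socket ∕ D1Tel ∕ D1Rep — 0); (K) NOT closed; NOT D1, NOT `BetaPertH`, NOT continuum, NOT Clay. -/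
theorem d1Drift_BFx_of_prop12S' (Js : ℕ → JetData 3 Lc) (hμν : μ ≠ ν) (hN : N ≠ 0) (hL : 2 ≤ Lc) (hodd : Odd Lc)
    (ha : 0 < a) (c : ℕ → ℝ) {A₂ δ₂ : ℝ} (hD₂ : 0 ≤ D₂) (hA₂ : 0 ≤ A₂) (hδ₂ : 0 < δ₂)
    (h12 : B5.Prop12Printed (fam nOf hn1 MOf a ha)) (h126 : B5.Kernel126_127Printed (kfam nOf MOf))
    (h2s : ∀ n : ℕ, 2 ≤ n → ∀ [NeZero n], ∀ b ∈ (univ : Finset (Fin 4 → Fin n)).image resSite, ∀ r : ℕ, r + 1 ≤ n →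
      ∑ v ∈ annulus 4 r (r + 1), |(gfrz n a b (v + unitVec ν + unitVec μ) - gFree (v + unitVec ν + unitVec μ)) -
          (gfrz n a b (v + unitVec ν) - gFree (v + unitVec ν)) - (gfrz n a b (v + unitVec μ) - gFree (v + unitVec μ)) +
          (gfrz n a b v - gFree v)| ≤ D₂ / (n : ℝ))
    (d2s : ∀ n : ℕ, 2 ≤ n → ∀ [NeZero n], ∀ b ∈ (univ : Finset (Fin 4 → Fin n)).image resSite, ∀ r : ℕ, n ≤ r →
      ∑ v ∈ annulus 4 r (r + 1), |gfrz n a b (v + unitVec ν + unitVec μ) - gfrz n a b (v + unitVec ν) - gfrz n a b (v + unitVec μ) + gfrz n a b v| ≤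
        A₂ * Real.exp (-(δ₂ / n) * ((r : ℝ) + 1)) / ((r : ℝ) + 1))
    (hB1 : ∀ m : ℕ, 1 ≤ m → |(∑ j ∈ range m, B12Beta.secondMoment (TbalOf Lc Js j) μ ν) - c (Lc ^ m)| ≤ U₁)
    (hK : ∀ n : ℕ, 2 ≤ n → Odd n → ∀ [NeZero n], c n =
      ωgl n * B12Beta.secondMoment (TOfRed n a (SbfBal n a (cE n) (cVH n) (cΛ n) (cR n) (cK n) (cQ n))
        (tableRed n (Wbf (cE₂ n) (cJ4 n) (cΛ₂ n) (cR₂ n) (cQ₂ n) (WE n) (WJ n) (WΛ n) (WR n) (WQ n)))) μ ν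
      + ωgh n * B12Beta.secondMoment (PghQ n a (x₀ n) (cK n) (cQ n)) μ ν + ∑ u, Ru u n)
    -- the RESCALED loop-weight tie of reading (ii): displayed scalar family `s`, pinned `s n = n⁻²`; the normalisation
    (s : ℕ → ℝ) (hs : ∀ n : ℕ, 2 ≤ n → s n = ((n : ℝ) ^ 2)⁻¹) (hωs : ∀ n : ℕ, 2 ≤ n → ωgh n * (s n * cK n) ^ 2 = -2 * (ωgl n * cE n ^ 2))
    (hlam : ∀ n : ℕ, 2 ≤ n → ωgl n * cE n ^ 2 = 2 * N ^ 2 * (n : ℝ) ^ 8)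
    -- pins and the ray (the rows' letters)
    (hcE : ∀ n : ℕ, 2 ≤ n → cE n = (n : ℝ) ^ 4) (hRsgn : ∀ n : ℕ, 2 ≤ n → cR n = -cE n) (hJ4 : ∀ n : ℕ, cJ4 n = 0)
    (hcgh : ∀ n : ℕ, |cgh n| ≤ cgh₀) (hKray : ∀ n : ℕ, cK n = cgh n * (n : ℝ) ^ 2) (hQray : ∀ n : ℕ, cQ n = cgh n * a) (hx : ∀ n : ℕ, x₀ n = -cgh n)
    -- slot-table sockets (the END's), covariance, bond swap; `hdiv` (the ghost Ward rows `hrowgh` are a THEOREM on the ray: discharged inside)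
    (hδW : ∀ n, 0 < δW n)
    (hE : ∀ n κ u l u', BiLoc (WE n κ u l u') u u' (CE n) (δW n)) (hJ : ∀ n κ u l u', BiLoc (WJ n κ u l u') u u' (CJ n) (δW n))
    (hΛ : ∀ n κ u l u', BiLoc (WΛ n κ u l u') u u' (CΛt n) (δW n)) (hR : ∀ n κ u l u', BiLoc (WR n κ u l u') u u' (CRt n) (δW n))
    (hQ : ∀ n κ u l u', BiLoc (WQ n κ u l u') u u' (CQ n) (δW n))
    (hEc : ∀ (n : ℕ) (κ : Fin 4) (u : Site 4) (l : Fin 4) (u' t : Site 4),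
      WE n κ (u + (n : ℤ) • t) l (u' + (n : ℤ) • t) = shiftK (-((n : ℤ) • t)) (WE n κ u l u'))
    (hJc : ∀ (n : ℕ) (κ : Fin 4) (u : Site 4) (l : Fin 4) (u' t : Site 4),
      WJ n κ (u + (n : ℤ) • t) l (u' + (n : ℤ) • t) = shiftK (-((n : ℤ) • t)) (WJ n κ u l u'))
    (hΛc : ∀ (n : ℕ) (κ : Fin 4) (u : Site 4) (l : Fin 4) (u' t : Site 4),
      WΛ n κ (u + (n : ℤ) • t) l (u' + (n : ℤ) • t) = shiftK (-((n : ℤ) • t)) (WΛ n κ u l u'))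
    (hRc : ∀ (n : ℕ) (κ : Fin 4) (u : Site 4) (l : Fin 4) (u' t : Site 4),
      WR n κ (u + (n : ℤ) • t) l (u' + (n : ℤ) • t) = shiftK (-((n : ℤ) • t)) (WR n κ u l u'))
    (hQc : ∀ (n : ℕ) (κ : Fin 4) (u : Site 4) (l : Fin 4) (u' t : Site 4),
      WQ n κ (u + (n : ℤ) • t) l (u' + (n : ℤ) • t) = shiftK (-((n : ℤ) • t)) (WQ n κ u l u'))
    (hEs : ∀ n κ u l u', WE n κ u l u' = WE n l u' κ u) (hJs : ∀ n κ u l u', WJ n κ u l u' = WJ n l u' κ u)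
    (hΛs : ∀ n κ u l u', WΛ n κ u l u' = WΛ n l u' κ u) (hRs : ∀ n κ u l u', WR n κ u l u' = WR n l u' κ u)
    (hQs : ∀ n κ u l u', WQ n κ u l u' = WQ n l u' κ u)
    (hdiv : ∀ n : ℕ, 2 ≤ n → ∀ [NeZero n], ∀ (l' : Fin 4) (u' u : Site 4), ∑ κ' : Fin 4,
      (fineHess n a (SbfBal n a (cE n) (cVH n) (cΛ n) (cR n) (cK n) (cQ n))
          (Wbf (cE₂ n) (cJ4 n) (cΛ₂ n) (cR₂ n) (cQ₂ n) (WE n) (WJ n) (WΛ n) (WR n) (WQ n)) κ' l' (u - Pi.single κ' 1) u'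
        - fineHess n a (SbfBal n a (cE n) (cVH n) (cΛ n) (cR n) (cK n) (cQ n))
          (Wbf (cE₂ n) (cJ4 n) (cΛ₂ n) (cR₂ n) (cQ₂ n) (WE n) (WJ n) (WΛ n) (WR n) (WQ n)) κ' l' u u') = 0)
    -- (LOCAL) slot-E support and units; slot-R envelope and units (the three local ghost bubbles are SUPPLIED under reading (ii))
    {ρE : ℕ} {δ₀ kE : ℝ} (hδ₀ : 0 < δ₀) (hδE : ∀ n, δ₀ ≤ δW n)
    (hsuppE : ∀ n κ u l u', ρE < supNorm (u - u') → WE n κ u l u' = 0)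
    (hkE : ∀ n : ℕ, 2 ≤ n → |ωgl n * cE₂ n| * CE n ≤ kE * (n : ℝ) ^ 8)
    {CwR δR : ℕ → ℝ} {θR δ₀R kR : ℝ} (hθR : 0 < θR) (hδR : ∀ n, 0 < δR n) (hδ₀R : 0 < δ₀R) (hδRge : ∀ n : ℕ, δ₀R / n ≤ δR n) (hCwR : ∀ n, 0 ≤ CwR n)
    (hWRenv : ∀ n κ u l u', BiLoc (WR n κ u l u') u u' (CwR n * Real.exp (-(θR / n) * supNorm (u - u'))) (δR n))
    (hkR : ∀ n : ℕ, 2 ≤ n → |ωgl n * cR₂ n| * CwR n * (n : ℝ) ^ 6 ≤ kR)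
    -- (Λ) sockets and zero-momentum data
    (hδT : ∀ n, 0 < δT n)
    (hdec : ∀ n : ℕ, 2 ≤ n → ∀ [NeZero n], ∀ κ u l u', WΛ n κ u l u' =
      (∑ m : Fin 4, OneStepResolventKernel.wsum (onLat n (fun y => lamCoeffOf (KInv (N := n) (d := 3)) n m y l u'))
          (fun v => onLat n (fun y => TΛ n m y κ u) v))
      + (∑ m : Fin 4, OneStepResolventKernel.wsum (onLat n (fun y => lamCoeffOf (KInv (N := n) (d := 3)) n m y κ u))
          (fun v => onLat n (fun y => TΛ n m y l u') v))
      + WA n κ u l u')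
    (hTloc : ∀ (n : ℕ) m y κ u, BiLoc (TΛ n m y κ u) ((n : ℤ) • y) ((n : ℤ) • y) (CT n * Real.exp (-δT n * l1 ((n : ℤ) • y - u))) (δT n))
    (hWAa : ∀ n κ u l u', trK (WA n κ u l u') = -WA n κ u l u') (hWAl : ∀ n κ u l u', Loc (WA n κ u l u'))
    (hTcov : ∀ (n : ℕ) m y κ u t, TΛ n m (y + t) κ (u + (n : ℤ) • t) = shiftK (-((n : ℤ) • t)) (TΛ n m y κ u))
    (hcΛ : ∀ n : ℕ, 2 ≤ n → cΛ n ≠ 0) (hε : ∀ n : ℕ, ε n = 1 ∨ ε n = -1) (hδx : ∀ n, 0 < δx n) (hX : ∀ n u, BiLoc (X n u) u u (Cx n) (δx n))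
    (hW1 : ∀ n : ℕ, 2 ≤ n → ∀ [NeZero n], ∀ u,
      comp (comp (Ga n a) (divV (fun κ v => ε n • SbfBal n a (cE n) (cVH n) (cΛ n) (cR n) (cK n) (cQ n) κ v) u)) (Ga n a) =
        comp (Ga n a) (X n u) - comp (X n u) (Ga n a))
    (hW2 : ∀ n : ℕ, 2 ≤ n → ∀ [NeZero n], ∀ (m : Fin 4) (u : Site 4),
      divV (fun κ v => (-(ε n * (cΛ₂ n / cΛ n))) • TΛ n m 0 κ v) u = comp (X n u) (ffOf (hessFF n m 0)) - comp (ffOf (hessFF n m 0)) (X n u))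
    -- (N) slot Q's SOCKETS (the (A2) readout of `WQ`: a decaying bi-localisation envelope at a BLOCK-scale rate floor and its units line — T₈ ⟸ `NeedleTadpoleRowDecay`)
    {CwQ δQ : ℕ → ℝ} {θQ δ₀Q kQ : ℝ} (hθQ : 0 < θQ) (hδQ : ∀ n, 0 < δQ n) (hδ₀Q : 0 < δ₀Q) (hδQge : ∀ n : ℕ, δ₀Q / n ≤ δQ n) (hCwQ : ∀ n, 0 ≤ CwQ n)
    (hWQenv : ∀ n κ u l u', BiLoc (WQ n κ u l u') u u' (CwQ n * Real.exp (-(θQ / n) * supNorm (u - u'))) (δQ n))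
    (hkQ : ∀ n : ℕ, 2 ≤ n → |ωgl n * cQ₂ n| * CwQ n * (n : ℝ) ^ 6 ≤ kQ)
    -- (U)
    (hU : ∀ n : ℕ, 2 ≤ n → ∀ u, |Ru u n| ≤ CU u) :
    D1Drift Lc Js N μ ν := by
  -- (β) the ghost Ward rows on the ray
  have hrowgh : ∀ n : ℕ, 2 ≤ n → ∀ [NeZero n], ∀ (κ' l' : Fin 4) (b : Site 4), HasSum (fineHessGhQ n a (x₀ n) (cK n) (cQ n) κ' l' b) 0 := by
    intro n _ _ κ' l' b
    rw [hx n, hKray n, hQray n]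
    exact hasSum_row_fineHessGhQ_ray n a ha (cgh n) κ' l' b
  -- (α) T₈ from slot Q's sockets
  exact d1Drift_BFx_of_prop12S Js hμν hN hL hodd ha c hD₂ hA₂ hδ₂ h12 h126 h2s d2s hB1 hK s hs hωs hlam hcE hRsgn hJ4 hcgh hKray hQray hx hδW hE hJ hΛ hR
    hQ hEc hJc hΛc hRc hQc hEs hJs hΛs hRs hQs hdiv hrowgh hδ₀ hδE hsuppE hkE hθR hδR hδ₀R hδRge hCwR hWRenv hkR hδT hdec hTloc hWAa hWAl hTcov hcΛ hε hδx
    hX hW1 hW2 (h₈_of_blockRate_scaling ha hθQ hδQ hδ₀Q hδQge hCwQ hWQenv hkQ μ ν) hU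

end Summit.QuantumFields.BalabanUV.Beta.D1BFx.RoadEndBFxWiredS

end
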